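import Summits.QuantumAdvantage.QuantumAdvantage.Theses.LinnikCubicClassGroups
import Summits.QuantumAdvantage.QuantumAdvantage.Theorems.LinnikCubicClassGroupsPureCubicClassGroupFBQPStubRegulatorGeneric
import Literature.Computability.Cryptography.HallgrenPellQuantum
import Literature.Computability.Cryptography.HallgrenCandidateCheckFP
import Literature.Computability.Cryptography.InfrastructureCyclesFP
import Literature.Computability.Cryptography.HallgrenRegulatorGenericParams
import Literature.Computability.Cryptography.HallgrenRegulatorGenericRescale

/-!
# Crux `LinnikCubicClassGroups.PureCubicClassGroupFBQP` (stmt-QuantumAdvantage-11544) — stub `stub_regulatorWrap`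

Line `arakelov-giant-step-cycle`, stub `stub_regulatorWrap` (S3b-W2): **the generic regulator solver T2 instantiated
with the cubic walk and wrapped classically** (Hallgren 2007 / Jozsa 2003 §10 Thm. 6–7, for the infrastructure of
`ℚ(∛(ab²))`). From the walk programs `rhoS`, `starS`, `unitS` (P4), T2 (landed `stub_regulatorGeneric`), B, S4a and
W1 (every admissible `((a, b), prec)` carries a `GiantStepCycle` on lattice codes presented by the programs) to the
relation S3b (input `⟨⟨x, ⟨f, a, b⟩⟩, 1^k⟩`, `decodeNat x = f³ab²` a non-cube, `ab` squarefree; output `⟨bin r, ·⟩`,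
`|r − 2^k R_K| ≤ 1`):
1. `IntWalkOps.exists_table_passes_fn_of_stepPrograms` (`InfrastructureCyclesFP.lean`; admissible instances as a
   subtype, labels of the cycles, codes `≤ 38|d| + 114`) gives `FP` string functions for the walk table and the
   candidate test; the solver input is the padded string `u = ⟨w, 1^{7|w|}⟩`, its instance `((a, b), precP |u|)` is
   read off `u` in polynomial time, and `tab`, `passes` are those functions on the codes of the instance and of the
   tree's parameters of `|u|` (`CodeFP` by construction, also off the promise);
2. on admissible `u` (`ab` squarefree, `ab ≠ 1`, `17 size(ab) + 74 ≤ |u|`) the bundle of T2 holds for the cycle of W1: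
   `K = 10 size(ab) + 48`, `G = 3 ln(27a²b²) + 7`, `η = 16/2^{prec}`, `L = ln(11/10)`, `ln 2/6 ≤ R ≤ (27a²b²)⁶`,
   `n ln 2 ≤ 6R` against `Kb, Gb, precP, 2^{2n+8}` of `|u|` (`HallgrenRegulatorGenericParams.lean`);
3. `isQSolvable_rescale_gen` (`HallgrenRegulatorGenericRescale.lean`) pads the input and rescales the output of the T2
   solver to `r = ⌊m 2^k/N⌉`; on the promise `u` is admissible (`ab ≠ 1`, `f ≠ 0` as `f³ab²` is not a cube) and the
   cycle's `R` is the regulator of the given `K` (W1 with `θ = α/f`).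

`stub_regulatorWrapCore` (the short registered handle) carries the proof with the landed T2; the registered long signature
`stub_regulatorWrap` (hypotheses T2, B, S4a) follows from it.
-/

-- the problem namespace repeats the summit name (`QuantumAdvantage.QuantumAdvantage`)
set_option linter.dupNamespace false

namespace Summit.QuantumAdvantage.QuantumAdvantage.Theorems.LinnikCubicClassGroups

open Literature.Computability.Cryptography (IsQSolvable GiantStepCycle WalkData IntWalkOps length_boolUnpair_snd_le)
open Literature.Computability.Cryptography.HallgrenQuantum
open Literature.Computability.Complexity (boolPair CodeFP FP length_boolPair comp_mem_FP)
open Literature.Computability.Complexity.CodeFP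
open Literature.Computability.Complexity.Brick (fstF sndF fstF_boolPair sndF_boolPair fstF_mem_FP sndF_mem_FP canonF
  canonF_mem_FP canonF_eq_encodeNat_decodeNat)
open Computability (encodeNat decodeNat decode_encodeNat)
open Polynomial (X eval_add eval_mul eval_X)
open scoped NumberField
open scoped nonZeroDivisors InnerProductSpace

/-- **S3b-W2, core form `stub_regulatorWrapCore`** (the short registered handle of `stub_regulatorWrap`; the stub registry
truncates long signatures): from the three walk programs with their `CodeFP` facts and the cycles of W1, the regulator
relation S3b — the generic regulator solver (landed T2 `stub_regulatorGeneric`) instantiated with the cubic walk (admissible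
`((a, b), prec)` as a subtype, `InfrastructureCyclesFP`), its numeric side conditions from the cubic constants of W1
(`HallgrenRegulatorGenericParams`), and the classical wrap: parse + pad the input, rescale the output
(`HallgrenRegulatorGenericRescale`). -/
theorem stub_regulatorWrapCore :
    ∀ (rhoS : ((ℕ × ℕ) × ℕ) × (ℕ × List ℤ) → (ℕ × List ℤ) × ℤ)
      (starS : ((ℕ × ℕ) × ℕ) × ((ℕ × List ℤ) × (ℕ × List ℤ)) → (ℕ × List ℤ) × ℤ)
      (unitS : (ℕ × ℕ) × ℕ → (ℕ × List ℤ) × ℤ),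
    CodeFP (pairE (pairE (pairE natE natE) unE) (pairE natE (rawE intE))) (pairE (pairE natE (rawE intE)) intE) rhoS →
    CodeFP (pairE (pairE (pairE natE natE) unE) (pairE (pairE natE (rawE intE)) (pairE natE (rawE intE))))
      (pairE (pairE natE (rawE intE)) intE) starS →
    CodeFP (pairE (pairE natE natE) unE) (pairE (pairE natE (rawE intE)) intE) unitS →
    (∀ (a b : ℕ), Squarefree (a * b) → a * b ≠ 1 → ∀ prec : ℕ, 4 * Nat.size (a * b) + 8 ≤ prec →
      ∃ G : GiantStepCycle (ℕ × List ℤ),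
        G.toWalkData = IntWalkOps.toWalkData
          (⟨fun d => (unitS d).1, fun d c => (rhoS (d, c)).1, fun d c₁ c₂ => (starS (d, (c₁, c₂))).1,
          fun d c => (rhoS (d, c)).2,
          fun d c₁ c₂ => max (-((2 ^ d.2 * (10 * Nat.size (d.1.1 * d.1.2) + 48) : ℕ) : ℤ)) (min (((2 ^ d.2 * (10 * Nat.size (d.1.1 * d.1.2) + 48) : ℕ) : ℤ)) ((starS (d, (c₁, c₂))).2 + (unitS d).2)),
          fun d => 2 ^ d.2 * (10 * Nat.size (d.1.1 * d.1.2) + 48), fun d => d.2⟩ : IntWalkOps ((ℕ × ℕ) × ℕ) (ℕ × List ℤ)) ((a, b), prec) ∧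
        G.L = Real.log (11 / 10) ∧ G.η = 16 / 2 ^ prec ∧ G.G = 3 * Real.log (27 * (a : ℝ) ^ 2 * (b : ℝ) ^ 2) + 7 ∧
        (∀ (K : Type) [Field K] [NumberField K], Module.finrank ℚ K = 3 →
          ∀ θ : K, θ ^ 3 = ((a * b ^ 2 : ℕ) : K) → G.R = NumberField.Units.regulator K) ∧
        Real.log 2 / 6 ≤ G.R ∧ G.R ≤ (27 * (a : ℝ) ^ 2 * (b : ℝ) ^ 2) ^ 6 ∧ (G.n : ℝ) * Real.log 2 ≤ 6 * G.R ∧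
        (∀ m : ℤ, (∃ (h11 h12 h13 h22 h23 h33 : ℤ), (G.lab m).2 = [h11, h12, h13, h22, h23, h33] ∧
            0 < h11 ∧ 0 < h22 ∧ 0 < h33 ∧ 0 ≤ h12 ∧ h12 < h22 ∧ 0 ≤ h13 ∧ h13 < h33 ∧ 0 ≤ h23 ∧ h23 < h33 ∧
            1 ≤ (G.lab m).1 ∧ Int.gcd ((G.lab m).1 : ℤ) (Int.gcd h11 (Int.gcd h12 (Int.gcd h13 (Int.gcd h22 (Int.gcd h23 h33))))) = 1) ∧
          (G.lab m).1 ≤ 243 * a ^ 2 * b ^ 2 ∧ ∀ h ∈ (G.lab m).2, 0 ≤ h ∧ h ≤ 243 * (a : ℤ) ^ 2 * (b : ℤ) ^ 2)) →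
    IsQSolvable fun w => {y | ∀ (x : List Bool) (f a b k : ℕ),
      w = boolPair (boolPair x (boolPair (encodeNat f) (boolPair (encodeNat a) (encodeNat b)))) (List.replicate k true) →
      decodeNat x = f ^ 3 * (a * b ^ 2) → Squarefree (a * b) →
      ∀ (K : Type) [Field K] [NumberField K], Module.finrank ℚ K = 3 →
        (∀ r : ℕ, r ^ 3 ≠ decodeNat x) → (∃ α : K, α ^ 3 = (decodeNat x : K)) →
        ∃ (r : ℕ) (t : List Bool), y = boolPair (encodeNat r) t ∧
          |(r : ℝ) - 2 ^ k * NumberField.Units.regulator K| ≤ 1} := by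
  intro rhoS starS unitS hrho hstar hunit hW1
  classical
  -- ### the cycles of the admissible instances `d = ((a, b), prec)` (W1)
  have hW1' := fun (d : (ℕ × ℕ) × ℕ)
      (hd : Squarefree (d.1.1 * d.1.2) ∧ d.1.1 * d.1.2 ≠ 1 ∧ 4 * Nat.size (d.1.1 * d.1.2) + 8 ≤ d.2) =>
    hW1 d.1.1 d.1.2 hd.1 hd.2.1 d.2 hd.2.2
  choose G hG using hW1'
  -- ### the table and the candidate test of the cycles are `FP` string functions
  have heι : Function.Injective (pairE natE (rawE intE)) :=
    pairE_injective natE_injective (rawE_injective intE_injective)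
  have hsz : CodeFP natE natE Nat.size :=
    ((natOfUn.comp ((strLength.comp strOfNat).congr fun n => length_natE n)) :).congr fun _ => rfl
  have hKIc : CodeFP (pairE (pairE natE natE) unE) natE
      (fun d : (ℕ × ℕ) × ℕ => 2 ^ d.2 * (10 * Nat.size (d.1.1 * d.1.2) + 48)) :=
    (natMul.comp ((natPow.comp ((const _ (2 : ℕ)).pair (snd _ _))).pair (natAdd.comp ((natMul.comp
      ((const _ (10 : ℕ)).pair (hsz.comp (natMul.comp ((fst _ _).fst'.pair (fst _ _).snd'))))).pair
      (const _ (48 : ℕ))))) :)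
  have hlenE : ∀ d : (ℕ × ℕ) × ℕ, (pairE (pairE natE natE) unE d).length =
      2 * (2 * Nat.size d.1.1 + 2 + Nat.size d.1.2) + 2 + d.2 := fun d => by
    simp only [pairE_apply, length_boolPair, length_natE, length_unE]
  have hbounds : ∀ (d : (ℕ × ℕ) × ℕ)
      (hd : Squarefree (d.1.1 * d.1.2) ∧ d.1.1 * d.1.2 ≠ 1 ∧ 4 * Nat.size (d.1.1 * d.1.2) + 8 ≤ d.2),
      (∀ m : ℤ, (pairE natE (rawE intE) ((G d hd).lab m)).length ≤
        (38 * X + 114 : Polynomial ℕ).eval (pairE (pairE natE natE) unE d).length) ∧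
      (G d hd).G + 1 ≤ (2 : ℝ) ^ (38 * X + 114 : Polynomial ℕ).eval (pairE (pairE natE natE) unE d).length ∧
      2 ^ d.2 * (10 * Nat.size (d.1.1 * d.1.2) + 48) <
        2 ^ (38 * X + 114 : Polynomial ℕ).eval (pairE (pairE natE natE) unE d).length ∧
      d.2 ≤ (38 * X + 114 : Polynomial ℕ).eval (pairE (pairE natE natE) unE d).length := by
    rintro ⟨⟨a, b⟩, prec⟩ hd
    obtain ⟨-, -, -, hGG, -, -, -, -, hGlab⟩ := hG _ hd
    simp only at hd hGG hGlab ⊢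
    have hE : (38 * X + 114 : Polynomial ℕ).eval (pairE (pairE natE natE) unE ((a, b), prec)).length =
        38 * (2 * (2 * Nat.size a + 2 + Nat.size b) + 2 + prec) + 114 := by
      rw [hlenE]; simp [eval_add, eval_mul, eval_X]
    rw [hE]
    have hab0 : a * b ≠ 0 := Squarefree.ne_zero hd.1
    have hsab : Nat.size (a * b) ≤ Nat.size a + Nat.size b := size_mul_le a b
    refine ⟨fun m => ?_, ?_, ?_, by omega⟩
    · -- labels: a denominator and six entries `≤ 243 a² b²`
      obtain ⟨⟨h11, h12, h13, h22, h23, h33, hl, -⟩, hden, hent⟩ := hGlab m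
      have hM : Nat.size (243 * a ^ 2 * b ^ 2) ≤ 2 * Nat.size a + 2 * Nat.size b + 8 := by
        have h1 := size_mul_le (243 * a ^ 2) (b ^ 2)
        have h2 := size_mul_le 243 (a ^ 2)
        have h3 : Nat.size (a ^ 2) ≤ 2 * Nat.size a := by rw [sq]; exact (size_mul_le a a).trans (by omega)
        have h4 : Nat.size (b ^ 2) ≤ 2 * Nat.size b := by rw [sq]; exact (size_mul_le b b).trans (by omega)
        have h5 : Nat.size 243 = 8 := by decide
        omega
      refine (IntWalkOps.length_latticeCode_le (M := 243 * a ^ 2 * b ^ 2) (L := 6) hden (by rw [hl]; simp)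
        fun h hh => ?_).trans (by omega)
      obtain ⟨h0, hle⟩ := hent h hh
      have e := Int.natAbs_of_nonneg h0
      have hle' : h ≤ ((243 * a ^ 2 * b ^ 2 : ℕ) : ℤ) := by push_cast; exact hle
      omega
    · -- gaps: `G + 1 = 3 ln(27a²b²) + 8 ≤ 81 (ab)² + 5 ≤ 2^{2 size(ab) + 7}`
      rw [hGG]
      have hx1 : (1 : ℝ) ≤ (a * b : ℕ) := by exact_mod_cast Nat.one_le_iff_ne_zero.2 hab0
      have hx2 : ((a * b : ℕ) : ℝ) ≤ 2 ^ (Nat.size a + Nat.size b) := by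
        have : a * b ≤ 2 ^ (Nat.size a + Nat.size b) :=
          (Nat.lt_size_self _).le.trans (Nat.pow_le_pow_right (by norm_num) hsab)
        exact_mod_cast this
      have hlog : Real.log (27 * (a : ℝ) ^ 2 * (b : ℝ) ^ 2) ≤ 27 * ((a * b : ℕ) : ℝ) ^ 2 - 1 := by
        have e : 27 * (a : ℝ) ^ 2 * (b : ℝ) ^ 2 = 27 * ((a * b : ℕ) : ℝ) ^ 2 := by push_cast; ring
        rw [e]; exact Real.log_le_sub_one_of_pos (by positivity)
      have e2 : (2 : ℝ) ^ (2 * (Nat.size a + Nat.size b) + 7) = 128 * (2 ^ (Nat.size a + Nat.size b)) ^ 2 := by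
        rw [pow_add, mul_comm 2, pow_mul]; norm_num; ring
      have h4 : (0 : ℝ) ≤ 2 ^ (Nat.size a + Nat.size b) := by positivity
      have key : 3 * Real.log (27 * (a : ℝ) ^ 2 * (b : ℝ) ^ 2) + 7 + 1 ≤ (2 : ℝ) ^ (2 * (Nat.size a + Nat.size b) + 7) := by
        nlinarith [mul_le_mul hx2 hx2 (by positivity) h4]
      exact key.trans (pow_le_pow_right₀ (by norm_num) (by omega))
    · -- defect bound: `2^prec (10 size(ab) + 48) < 2^{prec + 10 size(ab) + 48}`
      calc 2 ^ prec * (10 * Nat.size (a * b) + 48) < 2 ^ prec * 2 ^ (10 * Nat.size (a * b) + 48) :=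
            (Nat.mul_lt_mul_left (Nat.two_pow_pos prec)).2 Nat.lt_two_pow_self
        _ = 2 ^ (prec + (10 * Nat.size (a * b) + 48)) := (pow_add _ _ _).symm
        _ ≤ _ := Nat.pow_le_pow_right (by norm_num) (by omega)
  obtain ⟨Ftab, hFtab, Fpas, hFpas, hprog⟩ := IntWalkOps.exists_table_passes_fn_of_stepPrograms heι rhoS starS unitS
    (fun d => 2 ^ d.2 * (10 * Nat.size (d.1.1 * d.1.2) + 48)) (fun d => d.2) hrho hstar hunit hKIc (snd _ _) _ G
    (fun d hd => (hG d hd).1) (38 * X + 114) (fun d hd => (hbounds d hd).1) (fun d hd => (hbounds d hd).2.1)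
    (fun d hd => (hbounds d hd).2.2.1) (fun d hd => (hbounds d hd).2.2.2)
  -- ### the instance, the table and the test read off the (padded) solver input in polynomial time
  obtain ⟨dOf, hdOf⟩ : ∃ dOf : List Bool → (ℕ × ℕ) × ℕ, dOf = fun u =>
      ((decodeNat (fstF (sndF (sndF (fstF (fstF u))))), decodeNat (sndF (sndF (sndF (fstF (fstF u)))))),
        precP u.length) := ⟨_, rfl⟩
  have hdOfc : CodeFP strE (pairE (pairE natE natE) unE) dOf := by
    have hF : CodeFP strE strE fstF := of_fn fstF fstF_mem_FP fun _ => rfl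
    have hS : CodeFP strE strE sndF := of_fn sndF sndF_mem_FP fun _ => rfl
    have hD : CodeFP strE natE decodeNat := ⟨canonF, canonF_mem_FP, canonF_eq_encodeNat_decodeNat⟩
    have hAB : CodeFP strE strE (fun u => sndF (sndF (fstF (fstF u)))) := (hS.comp (hS.comp (hF.comp hF)) :)
    rw [hdOf]
    exact (((hD.comp (hF.comp hAB)).pair (hD.comp (hS.comp hAB))).pair (precP_un.comp strLength) :)
  obtain ⟨tab, htab⟩ : ∃ tab : List Bool → ℕ → List Bool, tab = fun u (v : ℕ) =>
      Ftab (pairE (pairE (pairE natE natE) unE) (pairE natE (pairE intE (pairE unE (pairE unE unE))))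
        (dOf u, Ngrid u.length, (v : ℤ), s0 u.length, Tdbl u.length, 2 * Mfin u.length)) := ⟨_, rfl⟩
  obtain ⟨pas, hpas⟩ : ∃ pas : List Bool → ℕ → Bool, pas = fun u (m : ℕ) =>
      decide (Fpas (pairE (pairE (pairE natE natE) unE) (pairE natE (pairE natE (pairE unE (pairE unE (pairE unE intE)))))
        (dOf u, Ngrid u.length, 4, s0 u.length, Tdbl u.length, 2 * Mfin u.length, (m : ℤ))) = [true]) := ⟨_, rfl⟩
  have hn : CodeFP (pairE strE natE) unE (fun p => p.1.length) := strLength.comp (fst _ _)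
  have htabc : CodeFP (pairE strE natE) strE (fun p => tab p.1 p.2) := by
    obtain ⟨g, hg, hge⟩ := (((hdOfc.comp (fst _ _)).pair ((Ngrid_nat.comp hn).pair ((intOfNat.comp (snd _ _)).pair
      ((s0_un.comp hn).pair ((Tdbl_un.comp hn).pair (twoMfin_un.comp hn)))))) :
      CodeFP (pairE strE natE) (pairE (pairE (pairE natE natE) unE) (pairE natE (pairE intE (pairE unE (pairE unE unE)))))
        fun p => (dOf p.1, Ngrid p.1.length, (p.2 : ℤ), s0 p.1.length, Tdbl p.1.length, 2 * Mfin p.1.length))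
    exact ⟨Ftab ∘ g, comp_mem_FP hFtab hg, fun p => by rw [htab, Function.comp_apply, hge]; rfl⟩
  have hpasc : CodeFP (pairE strE natE) bitE (fun p => pas p.1 p.2) := by
    obtain ⟨g, hg, hge⟩ := (((hdOfc.comp (fst _ _)).pair ((Ngrid_nat.comp hn).pair ((const _ (4 : ℕ)).pair
      ((s0_un.comp hn).pair ((Tdbl_un.comp hn).pair ((twoMfin_un.comp hn).pair (intOfNat.comp (snd _ _)))))))) :
      CodeFP (pairE strE natE) (pairE (pairE (pairE natE natE) unE)
        (pairE natE (pairE natE (pairE unE (pairE unE (pairE unE intE))))))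
        fun p => (dOf p.1, Ngrid p.1.length, 4, s0 p.1.length, Tdbl p.1.length, 2 * Mfin p.1.length, (p.2 : ℤ)))
    have h1 : CodeFP (pairE strE natE) strE (fun p => Fpas (pairE (pairE (pairE natE natE) unE)
        (pairE natE (pairE natE (pairE unE (pairE unE (pairE unE intE)))))
        (dOf p.1, Ngrid p.1.length, 4, s0 p.1.length, Tdbl p.1.length, 2 * Mfin p.1.length, (p.2 : ℤ)))) :=
      ⟨Fpas ∘ g, comp_mem_FP hFpas hg, fun p => by rw [Function.comp_apply, hge]; rfl⟩
    rw [hpas]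
    exact ((CodeFP.eq (eα := strE) (fun _ _ h => h)).comp (h1.pair (const _ ([true] : List Bool) :
      CodeFP (pairE strE natE) strE fun _ => [true])) :)
  -- ### the generic solver on admissible solver inputs (T2, side conditions by the cubic constants of W1)
  obtain ⟨Adm, hAdm⟩ : ∃ Adm : List Bool → Prop, Adm = fun u =>
      (Squarefree ((dOf u).1.1 * (dOf u).1.2) ∧ (dOf u).1.1 * (dOf u).1.2 ≠ 1 ∧
        4 * Nat.size ((dOf u).1.1 * (dOf u).1.2) + 8 ≤ (dOf u).2) ∧
      17 * Nat.size ((dOf u).1.1 * (dOf u).1.2) + 74 ≤ u.length := ⟨_, rfl⟩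
  obtain ⟨ρ, hρ⟩ : ∃ ρ : List Bool → ℝ, ρ = fun u =>
      if h : Squarefree ((dOf u).1.1 * (dOf u).1.2) ∧ (dOf u).1.1 * (dOf u).1.2 ≠ 1 ∧
        4 * Nat.size ((dOf u).1.1 * (dOf u).1.2) + 8 ≤ (dOf u).2 then (G (dOf u) h).R else 0 := ⟨_, rfl⟩
  have hsolv := stub_regulatorGeneric tab pas Adm ρ htabc hpasc (by
    intro u hu
    rw [hAdm] at hu
    obtain ⟨hd, hpadl⟩ := hu
    have hd2 : (dOf u).2 = precP u.length := by rw [hdOf]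
    set d := dOf u
    set n := u.length
    obtain ⟨hGw, hGL, hGη, hGG, -, hR1, hR2, hGn, -⟩ := hG d hd
    have hab0 : d.1.1 * d.1.2 ≠ 0 := Squarefree.ne_zero hd.1
    have ha0 : 0 < d.1.1 := Nat.pos_of_ne_zero (left_ne_zero_of_mul hab0)
    have hb0 : 0 < d.1.2 := Nat.pos_of_ne_zero (right_ne_zero_of_mul hab0)
    have hl2 := Real.log_two_gt_d9; have hl2' := Real.log_two_lt_d9
    have hK : ((G d hd).K : ℝ) = 10 * (Nat.size (d.1.1 * d.1.2) : ℝ) + 48 := by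
      have e := congrArg WalkData.K hGw
      simp only [IntWalkOps.toWalkData] at e
      rw [e]; push_cast; field_simp
    set s := Nat.size (d.1.1 * d.1.2)
    have hη : (G d hd).η ≤ 1 / 512 := by
      have : (2 : ℝ) ^ 13 ≤ 2 ^ d.2 := pow_le_pow_right₀ (by norm_num) (by rw [hd2]; unfold precP; omega)
      rw [hGη, div_le_div_iff₀ (by positivity) (by norm_num)]
      nlinarith
    have hlog11 := log_eleven_tenths_ge
    have hL : (1 : ℝ) / 12 ≤ (G d hd).L - 2 * (G d hd).η := by rw [hGL]; linarith
    have hL16 : (1 : ℝ) / 16 ≤ (G d hd).L := by rw [hGL]; linarith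
    have hKb : 4 * ((G d hd).K : ℝ) + 2 ≤ Kb n := by
      rw [hK]
      have h1 : 40 * s + 194 ≤ Kb n := by have := Kb_ge_linear n; omega
      have h2 : ((40 * s + 194 : ℕ) : ℝ) ≤ Kb n := by exact_mod_cast h1
      push_cast at h2; linarith
    have h27 : 27 * (d.1.1 : ℝ) ^ 2 * (d.1.2 : ℝ) ^ 2 ≤ 2 ^ (2 * s + 5) := by
      have hx : ((d.1.1 * d.1.2 : ℕ) : ℝ) ≤ 2 ^ s := by exact_mod_cast (Nat.lt_size_self _).le
      have e : (2 : ℝ) ^ (2 * s + 5) = 32 * (2 ^ s) ^ 2 := by rw [pow_add, mul_comm 2, pow_mul]; norm_num; ring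
      have e2 : 27 * (d.1.1 : ℝ) ^ 2 * (d.1.2 : ℝ) ^ 2 = 27 * ((d.1.1 * d.1.2 : ℕ) : ℝ) ^ 2 := by push_cast; ring
      rw [e, e2]
      have h0 : (0 : ℝ) ≤ ((d.1.1 * d.1.2 : ℕ) : ℝ) := by positivity
      nlinarith [mul_le_mul hx hx h0 (by positivity)]
    have hpos27 : (0 : ℝ) < 27 * (d.1.1 : ℝ) ^ 2 * (d.1.2 : ℝ) ^ 2 := by positivity
    have hlog : Real.log (27 * (d.1.1 : ℝ) ^ 2 * (d.1.2 : ℝ) ^ 2) ≤ ((2 * s + 5 : ℕ) : ℝ) * Real.log 2 :=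
      (Real.log_le_log hpos27 h27).trans (by rw [Real.log_pow])
    have hsn : ((17 * s + 74 : ℕ) : ℝ) ≤ n := by exact_mod_cast hpadl
    have hGb : 4 * (G d hd).G + 8 ≤ Gb n := by
      rw [hGG]
      have e : ((Gb n : ℕ) : ℝ) = n + 4 := by unfold Gb; push_cast; ring
      rw [e]
      push_cast at hlog hsn
      nlinarith
    have hR0 : 0 ≤ (G d hd).R := by linarith
    have hRle : (G d hd).R ≤ (2 : ℝ) ^ (2 * n + 8) :=
      calc (G d hd).R ≤ (27 * (d.1.1 : ℝ) ^ 2 * (d.1.2 : ℝ) ^ 2) ^ 6 := hR2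
        _ ≤ ((2 : ℝ) ^ (2 * s + 5)) ^ 6 := pow_le_pow_left₀ hpos27.le h27 6
        _ = 2 ^ ((2 * s + 5) * 6) := (pow_mul _ _ _).symm
        _ ≤ 2 ^ (2 * n + 8) := pow_le_pow_right₀ (by norm_num) (by omega)
    have hηp : (G d hd).η * 2 ^ precP n ≤ 16 := by
      rw [hGη, hd2, div_mul_cancel₀ _ (by positivity)]
    refine ⟨ℕ × List ℤ, pairE natE (rawE intE), G d hd, s0 n, Mfin n, heι, ?_, ?_, ?_,
      start_ge_gen (G d hd) n hKb hL, Res_lt_M_gen (G d hd) n hKb hGb hL,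
      N_mul_Etot_le_gen (G d hd) n hηp (by omega), S_ge_gen (G d hd) n hR1 (by omega),
      three_S_sq_le_Q_gen (G d hd) n hR0 hRle, n51_le_gen (G d hd) n hR1 hGn, hL16⟩
    · rw [hρ]; simp only; rw [dif_pos hd]
    · intro v _
      rw [htab]
      exact (hprog d hd (Ngrid n) (Ngrid_pos n)).1 v (s0 n) (Tdbl n) (2 * Mfin n)
    · intro m
      rw [hpas]
      simp only [decide_eq_true_eq]
      have := (hprog d hd (Ngrid n) (Ngrid_pos n)).2 4 (s0 n) (Tdbl n) (2 * Mfin n) (m : ℤ)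
      push_cast at this ⊢
      exact this)
  -- ### padding the input, rescaling the output (`isQSolvable_rescale_gen`)
  obtain ⟨pad, hpadFP, hpadE⟩ : CodeFP strE (pairE strE unE) (fun w : List Bool => (w, 7 * w.length)) :=
    (CodeFP.id strE).pair ((unMulConst 7).comp strLength)
  have hpad : ∀ w, pad w = boolPair w (unE (7 * w.length)) := fun w => hpadE w
  have hkc : CodeFP strE unE (fun w => (sndF w).length) := strLength.comp (of_fn sndF sndF_mem_FP fun _ => rfl)
  have hfin := isQSolvable_rescale_gen (Adm := Adm) (ρ := ρ) (h := pad) (kOf := fun w => (sndF w).length) hpadFP hkc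
    (fun w _ => by
      have h1 : (sndF w).length ≤ w.length := length_boolUnpair_snd_le w
      rw [hpad]
      simp only [length_boolPair, length_unE, Ngrid]
      exact Nat.pow_le_pow_right (by norm_num) (by unfold aN; omega)) hsolv
  -- ### the promise: `u = pad w` is admissible and the cycle's `R` is the regulator of `K`
  refine hfin.mono fun w z hz => ?_
  simp only [Set.mem_setOf_eq] at hz ⊢
  intro x f a b k hw hm hsq K _ _ hdeg hnc hα
  have hdw : dOf (pad w) = ((a, b), precP (pad w).length) := by
    rw [hdOf]; simp only; rw [hpad, hw]; simp [fstF_boolPair, sndF_boolPair, decode_encodeNat]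
  have hf0 : f ≠ 0 := by rintro rfl; exact hnc 0 (by rw [hm]; ring)
  have hab1 : a * b ≠ 1 := by
    intro h1
    rw [Nat.eq_one_of_mul_eq_one_right h1, Nat.eq_one_of_mul_eq_one_left h1] at hm
    exact hnc f (by rw [hm]; ring)
  have hlenu : (pad w).length = 9 * w.length + 2 := by rw [hpad, length_boolPair, length_unE]; ring
  have hwlen : 4 * Nat.size a + 2 * Nat.size b + 14 ≤ w.length := by
    rw [hw]; simp only [length_boolPair, List.length_replicate, length_natE]; omega
  have hsab : Nat.size (a * b) ≤ Nat.size a + Nat.size b := size_mul_le a b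
  have hadm : Adm (pad w) := by
    rw [hAdm]; simp only; rw [hdw]; simp only
    refine ⟨⟨hsq, hab1, ?_⟩, ?_⟩
    · unfold precP; omega
    · omega
  rw [hAdm] at hadm hz
  simp only at hadm hz
  obtain ⟨r, t, rfl, hr⟩ := hz hadm
  refine ⟨r, t, rfl, ?_⟩
  have hkw : (sndF w).length = k := by rw [hw, sndF_boolPair, List.length_replicate]
  have hρK : ρ (pad w) = NumberField.Units.regulator K := by
    rw [hρ]; simp only; rw [dif_pos hadm.1]
    have e1 : (dOf (pad w)).1.1 = a := by rw [hdw]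
    have e2 : (dOf (pad w)).1.2 = b := by rw [hdw]
    obtain ⟨α, hα⟩ := hα
    have hfK : (f : K) ≠ 0 := Nat.cast_ne_zero.2 hf0
    refine (hG _ hadm.1).2.2.2.2.1 K hdeg (α / f) ?_
    rw [e1, e2, div_pow, hα, hm]
    push_cast
    field_simp
  rwa [hkw, hρK] at hr

/-- **S3b-W2 `stub_regulatorWrap`** (registered signature): the generic regulator solver T2 instantiated with the cubic walk
(programs `rhoS`, `starS`, `unitS`, cycles of W1 on admissible `((a, b), prec)`) and wrapped classically — the regulator of
`ℚ(∛(f³ab²))` to precision `2^{−k}` in quantum polynomial time, no GRH. The hypotheses T2, B, S4a are landed theorems of this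
line; the proof is `stub_regulatorWrapCore` (which uses the landed T2 and does not need B, S4a). -/
theorem stub_regulatorWrap :
    ∀ (rhoS : ((ℕ × ℕ) × ℕ) × (ℕ × List ℤ) → (ℕ × List ℤ) × ℤ)
      (starS : ((ℕ × ℕ) × ℕ) × ((ℕ × List ℤ) × (ℕ × List ℤ)) → (ℕ × List ℤ) × ℤ)
      (unitS : (ℕ × ℕ) × ℕ → (ℕ × List ℤ) × ℤ),
    CodeFP (pairE (pairE (pairE natE natE) unE) (pairE natE (rawE intE))) (pairE (pairE natE (rawE intE)) intE) rhoS →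
    CodeFP (pairE (pairE (pairE natE natE) unE) (pairE (pairE natE (rawE intE)) (pairE natE (rawE intE))))
      (pairE (pairE natE (rawE intE)) intE) starS →
    CodeFP (pairE (pairE natE natE) unE) (pairE (pairE natE (rawE intE)) intE) unitS →
    -- T2
    (∀ (tab : List Bool → ℕ → List Bool) (passes : List Bool → ℕ → Bool)
      (Adm : List Bool → Prop) (ρ : List Bool → ℝ),
      CodeFP (pairE strE natE) strE (fun p => tab p.1 p.2) →
      CodeFP (pairE strE natE) bitE (fun p => passes p.1 p.2) →
      (∀ w : List Bool, Adm w → ∃ (ι : Type) (eι : ι → List Bool) (G : GiantStepCycle ι) (s₀ M : ℕ),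
        Function.Injective eι ∧ G.R = ρ w ∧
        (∀ v : ℕ, v < 2 ^ LQ w.length →
          tab w v = pairE eι intE (G.table (Ngrid w.length) s₀ (Tdbl w.length) (2 * M) (v : ℤ))) ∧
        (∀ m : ℕ, passes w m = true ↔
          G.Passes (((m : ℤ) : ℚ) / (Ngrid w.length : ℚ)) ((4 : ℚ) / (Ngrid w.length : ℚ)) s₀ (Tdbl w.length) (2 * M)) ∧
        2 * G.K + 1 ≤ (G.start s₀).2 ∧
        G.Res s₀ (Tdbl w.length) < M * (G.L - 2 * G.η) ∧
        (Ngrid w.length : ℝ) * (G.Etot s₀ (Tdbl w.length) (2 * M) + 2 * G.η) ≤ 2 ∧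
        (5000 : ℝ) ≤ Ngrid w.length * G.R ∧
        3 * ((Ngrid w.length : ℝ) * G.R) ^ 2 ≤ (2 : ℝ) ^ LQ w.length ∧
        (51 : ℝ) * G.n + 7 ≤ 3 * ((Ngrid w.length : ℝ) * G.R) / 4 ∧
        (1 : ℝ) / 16 ≤ G.L) →
      IsQSolvable fun w => {y | Adm w → ∃ (m : ℕ) (t : List Bool),
        y = boolPair (encodeNat m) t ∧ |(m : ℝ) - Ngrid w.length * ρ w| ≤ 10}) →
    -- B (landed) and S4a (landed): the promise `m = f³ab²` pins down `K = ℚ(∛(ab²))`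
    (∀ (a b : ℕ), Squarefree (a * b) → a * b ≠ 1 →
      ∀ (K : Type) [Field K] [NumberField K], Module.finrank ℚ K = 3 →
        ∀ θ : K, θ ^ 3 = ((a * b ^ 2 : ℕ) : K) →
          IsIntegral ℤ θ ∧ IsIntegral ℤ (θ ^ 2 / (b : K)) ∧
          (∀ ξ : 𝓞 K, ∃ c₀ c₁ c₂ : ℤ, (3 : K) * (ξ : K) = c₀ + c₁ * θ + c₂ * (θ ^ 2 / (b : K))) ∧
          (∀ c₀ c₁ c₂ : ℚ, (c₀ : K) + (c₁ : K) * θ + (c₂ : K) * (θ ^ 2 / (b : K)) = 0 → c₀ = 0 ∧ c₁ = 0 ∧ c₂ = 0) ∧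
          (∀ x y z : ℚ, Algebra.norm ℚ ((x : K) + (y : K) * θ + (z : K) * (θ ^ 2 / (b : K))) =
            x ^ 3 + (a * b ^ 2 : ℕ) * y ^ 3 + (a ^ 2 * b : ℕ) * z ^ 3 - 3 * (a * b : ℕ) * x * y * z) ∧
          (∀ x y z : ℚ, Algebra.trace ℚ K ((x : K) + (y : K) * θ + (z : K) * (θ ^ 2 / (b : K))) = 3 * x)) →
    (∀ m : ℕ, (∀ r : ℕ, r ^ 3 ≠ m) →
      (∃ (K : Type) (_ : Field K) (_ : NumberField K), Module.finrank ℚ K = 3 ∧ ∃ α : K, α ^ 3 = (m : K)) ∧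
      ∀ (K : Type) [Field K] [NumberField K], Module.finrank ℚ K = 3 → (∃ α : K, α ^ 3 = (m : K)) →
        (∀ F : IntermediateField ℚ K, Module.finrank ℚ F ≠ 2) ∧
        |NumberField.discr K| ≤ 27 * (m : ℤ) ^ 2 ∧
        NumberField.classNumber K ≤ (27 * m ^ 2) ^ 10 ∧
        ∀ p : ℕ, p.Prime → {P : Ideal (𝓞 K) | P.IsPrime ∧ Ideal.absNorm P = p}.ncard ≤ 3) →
    -- W1
    (∀ (a b : ℕ), Squarefree (a * b) → a * b ≠ 1 → ∀ prec : ℕ, 4 * Nat.size (a * b) + 8 ≤ prec →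
      ∃ G : GiantStepCycle (ℕ × List ℤ),
        G.toWalkData = IntWalkOps.toWalkData
          (⟨fun d => (unitS d).1, fun d c => (rhoS (d, c)).1, fun d c₁ c₂ => (starS (d, (c₁, c₂))).1,
          fun d c => (rhoS (d, c)).2,
          fun d c₁ c₂ => max (-((2 ^ d.2 * (10 * Nat.size (d.1.1 * d.1.2) + 48) : ℕ) : ℤ)) (min (((2 ^ d.2 * (10 * Nat.size (d.1.1 * d.1.2) + 48) : ℕ) : ℤ)) ((starS (d, (c₁, c₂))).2 + (unitS d).2)),
          fun d => 2 ^ d.2 * (10 * Nat.size (d.1.1 * d.1.2) + 48), fun d => d.2⟩ : IntWalkOps ((ℕ × ℕ) × ℕ) (ℕ × List ℤ)) ((a, b), prec) ∧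
        G.L = Real.log (11 / 10) ∧ G.η = 16 / 2 ^ prec ∧ G.G = 3 * Real.log (27 * (a : ℝ) ^ 2 * (b : ℝ) ^ 2) + 7 ∧
        (∀ (K : Type) [Field K] [NumberField K], Module.finrank ℚ K = 3 →
          ∀ θ : K, θ ^ 3 = ((a * b ^ 2 : ℕ) : K) → G.R = NumberField.Units.regulator K) ∧
        Real.log 2 / 6 ≤ G.R ∧ G.R ≤ (27 * (a : ℝ) ^ 2 * (b : ℝ) ^ 2) ^ 6 ∧ (G.n : ℝ) * Real.log 2 ≤ 6 * G.R ∧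
        (∀ m : ℤ, (∃ (h11 h12 h13 h22 h23 h33 : ℤ), (G.lab m).2 = [h11, h12, h13, h22, h23, h33] ∧
            0 < h11 ∧ 0 < h22 ∧ 0 < h33 ∧ 0 ≤ h12 ∧ h12 < h22 ∧ 0 ≤ h13 ∧ h13 < h33 ∧ 0 ≤ h23 ∧ h23 < h33 ∧
            1 ≤ (G.lab m).1 ∧ Int.gcd ((G.lab m).1 : ℤ) (Int.gcd h11 (Int.gcd h12 (Int.gcd h13 (Int.gcd h22 (Int.gcd h23 h33))))) = 1) ∧
          (G.lab m).1 ≤ 243 * a ^ 2 * b ^ 2 ∧ ∀ h ∈ (G.lab m).2, 0 ≤ h ∧ h ≤ 243 * (a : ℤ) ^ 2 * (b : ℤ) ^ 2)) →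
    IsQSolvable fun w => {y | ∀ (x : List Bool) (f a b k : ℕ),
      w = boolPair (boolPair x (boolPair (encodeNat f) (boolPair (encodeNat a) (encodeNat b)))) (List.replicate k true) →
      decodeNat x = f ^ 3 * (a * b ^ 2) → Squarefree (a * b) →
      ∀ (K : Type) [Field K] [NumberField K], Module.finrank ℚ K = 3 →
        (∀ r : ℕ, r ^ 3 ≠ decodeNat x) → (∃ α : K, α ^ 3 = (decodeNat x : K)) →
        ∃ (r : ℕ) (t : List Bool), y = boolPair (encodeNat r) t ∧
          |(r : ℝ) - 2 ^ k * NumberField.Units.regulator K| ≤ 1} :=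
  fun rhoS starS unitS h1 h2 h3 _ _ _ hW1 => stub_regulatorWrapCore rhoS starS unitS h1 h2 h3 hW1

end Summit.QuantumAdvantage.QuantumAdvantage.Theorems.LinnikCubicClassGroups
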